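import Mathlib
import Summits.Ventures.PercRepro.TriangleCapTEven
import Summits.Ventures.PercRepro.TriangleCapOutDeg

/-!
# PercRepro — EVERY ROW `m = k − 1 + t` OF THE `K₄⁻`-FREE CHERRY TABLE FOR `t ≥ 4` AND `k ≥ (t² − t + 6)/2`:
`Σ_v C(d(v), 2) ≤ C(k − 1, 2) + 2t` (p3, gen 31; part 9 — the rows `m = k + 2` and `m = k + 3` as one theorem)

The star plus `t` disjoint leaf edges has `k − 1 + t` edges and `C(k − 1, 2) + 2t` cherries; the competitor
`K_{2,t+1}` plus `k − t − 3` pendant edges at one big vertex has `C(k − 2, 2) + C(t + 1, 2) + t + 1`, which the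
star beats exactly when `k ≥ (t² − t + 6)/2` — `6` at `t = 3`, `9` at `t = 4`, `13` at `t = 5` (the ties `(6, 8)`
and `(9, 12)` of the census).  **`cherries_le_choose_two_add_two_mul_of_k4mFree`** proves the star value as the
upper bound for every `t ≥ 4` above that threshold (`t * t + 6 ≤ 2k + t`), with the tools of TriangleCapAvoid,
TriangleCapTEven and TriangleCapOutDeg: at a vertex `v` of MAXIMUM degree `d = t + 1 + a` (`k = t + 2 + a + g`)
the count reads `4·cherries ≤ 4(C(k − 1, 2) + 2t) + 2T + 2t(t − 3) − Y − 4ag`, and `2T + 2t(t − 3) ≤ Y + 4ag`: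
`g = 0` (the dominating vertex: `T = 2t`, `Y ≥ T(T − 2)/2`); `a = 0` (maximum degree `t + 1`: the defect sum seen
from a vertex of maximum off-degree gives `Y ≥ 2(t − 1)²`); `a, g ≥ 1` (`ag ≥ a + g − 1 ≥ t(t − 3)/2` from the
threshold, and `Y ≥ 2T` by `T² ≤ 2Y + 2T`, `Y ≥ |R|` or `Y ≥ 4`).  Degrees `≤ t` give `cherries ≤ (t − 1)m`
directly.  The rows `t ≤ 4` with their extremal graphs are TriangleCapRowPlusTwo / StarPlusThree /
RowPlusThree / StarPlusFour (`t = 3` needs the separate Erdős–Ko–Rado step below the `t ≥ 4` arithmetic).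
Axioms: standard.
-/

namespace PercRepro

namespace TriangleCap

namespace C047

open Finset

variable {V : Type*} [Fintype V] [DecidableEq V]

/-- `2·C(d, 2) ≤ (t − 1)·d` for `d ≤ t`. -/
theorem two_mul_choose_two_le_pred_mul (d t : ℕ) (h : d ≤ t) : 2 * d.choose 2 ≤ (t - 1) * d := by
  rcases d with _ | d
  · simp
  · obtain ⟨u, rfl⟩ : ∃ u, t = u + 1 := ⟨t - 1, by omega⟩
    rw [Nat.add_sub_cancel]
    have h1 := two_mul_choose_two_add (d + 1)
    have h2 : (d + 1) * d ≤ (d + 1) * u := Nat.mul_le_mul_left (d + 1) (by omega)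
    nlinarith [h1, h2]

/-- The degree-cap arithmetic (`t = s + 4`, `K = k − 1`): `(s + 3)(K + s + 4) ≤ C(K, 2) + 2(s + 4)` when `(s + 4)² + 6 ≤ 2(K + 1) + s + 4`. -/
theorem degree_cap_arith (K s : ℕ) (hk : (s + 4) * (s + 4) + 6 ≤ 2 * (K + 1) + (s + 4)) :
    (s + 3) * (K + (s + 4)) ≤ K.choose 2 + 2 * (s + 4) := by
  have hC := two_mul_choose_two_add K
  have hsq : (s + 4) * (s + 4) = s * s + 8 * s + 16 := by ring
  rw [hsq] at hk
  obtain ⟨y, hy⟩ : ∃ y, 2 * K = s * s + 7 * s + 16 + y := ⟨2 * K - (s * s + 7 * s + 16), by omega⟩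
  have hQ : 8 * K.choose 2 + 2 * (2 * K) = (2 * K) * (2 * K) := by nlinarith [hC]
  have h8 : 8 * ((s + 3) * (K + (s + 4))) = 4 * (s + 3) * (2 * K) + 8 * (s + 3) * (s + 4) := by ring
  rw [hy] at hQ h8
  have key : 8 * ((s + 3) * (K + (s + 4))) + s * (s * s * s + 10 * s * s + 31 * s + 22) +
      y * (2 * s * s + 10 * s + 18) + y * y = 8 * K.choose 2 + 16 * (s + 4) := by
    rw [h8]
    nlinarith [hQ]
  omega

/-- `a + g ≤ ag + 1` for `a, g ≥ 1`. -/
theorem add_le_mul_add_one (a g : ℕ) (ha : 1 ≤ a) (hg : 1 ≤ g) : a + g ≤ a * g + 1 := by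
  obtain ⟨a', rfl⟩ : ∃ a', a = a' + 1 := ⟨a - 1, by omega⟩
  obtain ⟨g', rfl⟩ : ∃ g', g = g' + 1 := ⟨g - 1, by omega⟩
  nlinarith [Nat.zero_le (a' * g')]

/-- The defect-sum arithmetic at maximum degree `s + 5` seen from a vertex of off-degree `δ ≥ 4`: `(s + 3)² ≤ 2(m′ − δ)(δ − 2)` when `4 ≤ δ ≤ s + 5` and `2m′ ≥ s² + 7s + 14`. -/
theorem off_degree_arith (m' δ s : ℕ) (h4 : 4 ≤ δ) (hδ : δ ≤ s + 5) (hm : s * s + 7 * s + 14 ≤ 2 * m') :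
    (s + 3) * (s + 3) ≤ 2 * ((m' - δ) * (δ - 2)) := by
  obtain ⟨x, rfl⟩ : ∃ x, δ = 4 + x := ⟨δ - 4, by omega⟩
  obtain ⟨w, hw⟩ : ∃ w, s + 1 = x + w := ⟨s + 1 - x, by omega⟩
  obtain ⟨z, hz⟩ : ∃ z, m' = 4 + x + z := ⟨m' - (4 + x), by omega⟩
  subst hz
  have e1 : 4 + x + z - (4 + x) = z := by omega
  have e2 : 4 + x - 2 = 2 + x := by omega
  rw [e1, e2]
  have hxw : x * (s + 1) = x * (x + w) := by rw [hw]
  have hxm : x * (s * s + 7 * s + 14) ≤ x * (2 * (4 + x + z)) := Nat.mul_le_mul_left x hm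
  nlinarith [hm, hxw, hxm, Nat.zero_le (x * w), Nat.zero_le (x * s * s), Nat.zero_le (x * s),
    Nat.zero_le (s * s), Nat.zero_le s, Nat.zero_le x, Nat.zero_le (x * z)]

/-- The final arithmetic of the general row: with `t = s + 4`, `d = s + 5 + a`, `k − 1 = s + 5 + a + g`, `m = 2s + 9 + a + g`, `|R| = 2(g + s + 4)`, the combined bound and `2T + 2(s + 4)(s + 1) ≤ Y + 4ag` give `cherries ≤ C(k − 1, 2) + 2(s + 4)`. -/
theorem row_general_arith (s2 Y T a g s ch C : ℕ)
    (hfin : 2 * s2 + (2 * (g + (s + 4))) * (s + 5 + a) + Y ≤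
      2 * ((s + 5 + a) * (s + 5 + a)) + 2 * (s + 5 + a) + 2 * (2 * (g + (s + 4))) + 2 * T +
        (2 * (g + (s + 4))) * (2 * s + 9 + a + g) + 2 * (g + (s + 4)))
    (hc : 2 * ch + 2 * (2 * s + 9 + a + g) = s2)
    (hC : 2 * C + (s + 5 + a + g) = (s + 5 + a + g) * (s + 5 + a + g))
    (hkey : 2 * T + 2 * (s + 4) * (s + 1) ≤ Y + 4 * (a * g)) : ch ≤ C + 2 * (s + 4) := by
  nlinarith [hfin, hc, hC, hkey]

/-- The threshold `(s + 4)² + 6 ≤ 2k + s + 4` with `k = s + 6 + a + g` reads `(s + 2)(s + 3) ≤ 2(a + g)`. -/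
theorem threshold_arith (s a g : ℕ) (hk : (s + 4) * (s + 4) + 6 ≤ 2 * (s + 6 + a + g) + (s + 4)) :
    (s + 2) * (s + 3) ≤ 2 * (a + g) := by
  ring_nf at hk ⊢
  omega

/-- At `a = 0` the threshold gives `2m′ = 2(g + s + 4) ≥ s² + 7s + 14`. -/
theorem hm2_arith (s g : ℕ) (hag0 : (s + 2) * (s + 3) ≤ 2 * (0 + g)) :
    s * s + 7 * s + 14 ≤ 2 * (g + (s + 4)) := by
  ring_nf at hag0 ⊢
  omega

/-- At `a = 0` the threshold gives `m′ = g + s + 4 ≥ s + 7`. -/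
theorem hm7_arith (s g : ℕ) (hag0 : (s + 2) * (s + 3) ≤ 2 * (0 + g)) : s + 7 ≤ g + (s + 4) := by
  ring_nf at hag0
  nlinarith [hag0, Nat.zero_le (s * s)]

/-- `Y ≥ 4(m′ − δ)(δ − 2) ≥ 2(s + 3)²`: the two halves of the defect sum seen from `c` combined with the off-degree arithmetic. -/
theorem combine_delta (g s δ Y : ℕ) (hδ1 : (2 * (g + (s + 4)) - 2 * δ) * (δ - 2) +
      (g + (s + 4) - δ) * (2 * δ - 4) ≤ Y)
    (h : (s + 3) * (s + 3) ≤ 2 * ((g + (s + 4) - δ) * (δ - 2))) (hδ : 2 ≤ δ) :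
    2 * ((s + 3) * (s + 3)) ≤ Y := by
  have h1 : 2 * (g + (s + 4)) - 2 * δ = 2 * (g + (s + 4) - δ) := by omega
  have h2 : 2 * δ - 4 = 2 * (δ - 2) := by omega
  rw [h1, h2] at hδ1
  have h3 : 2 * (g + (s + 4) - δ) * (δ - 2) + (g + (s + 4) - δ) * (2 * (δ - 2)) =
      4 * ((g + (s + 4) - δ) * (δ - 2)) := by ring
  rw [h3] at hδ1
  omega

/-- `Y ≥ 2m′(m′ − 5) ≥ 2(s + 3)²` when every off-degree is `≤ 3`. -/
theorem combine_small (g s Y : ℕ) (h : 2 * (g + (s + 4)) * (g + (s + 4) - 5) ≤ Y)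
    (hm7 : s + 7 ≤ g + (s + 4)) : 2 * ((s + 3) * (s + 3)) ≤ Y := by
  have h' : 2 * (s + 7) * (s + 2) ≤ 2 * (g + (s + 4)) * (g + (s + 4) - 5) :=
    Nat.mul_le_mul (by omega) (by omega)
  have h'' : 2 * ((s + 3) * (s + 3)) ≤ 2 * (s + 7) * (s + 2) := by
    ring_nf
    omega
  omega

/-- The dominating case `g = 0`: `T = 2t` and `T² ≤ 2Y + 2T` give the key inequality. -/
theorem g0_arith (s a Y T : ℕ) (hT2 : T = 2 * (0 + (s + 4))) (hTT : T * T ≤ 2 * Y + 2 * T) :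
    2 * T + 2 * (s + 4) * (s + 1) ≤ Y + 4 * (a * 0) := by
  subst hT2
  ring_nf at hTT ⊢
  omega

/-- The case `a = 0`: `Y ≥ 2(s + 3)²` and `T ≤ s + 5` give the key inequality. -/
theorem a0_arith (s g Y T : ℕ) (h : 2 * ((s + 3) * (s + 3)) ≤ Y) (hT : T ≤ s + 5 + 0) :
    2 * T + 2 * (s + 4) * (s + 1) ≤ Y + 4 * (0 * g) := by
  ring_nf at h ⊢
  omega

/-- The case `a, g ≥ 1`: `Y ≥ 2T`, `ag ≥ a + g − 1` and the threshold give the key inequality. -/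
theorem ag_arith (s a g Y T : ℕ) (hY : 2 * T ≤ Y) (hag : a + g ≤ a * g + 1)
    (hag0 : (s + 2) * (s + 3) ≤ 2 * (a + g)) :
    2 * T + 2 * (s + 4) * (s + 1) ≤ Y + 4 * (a * g) := by
  ring_nf at hag0 ⊢
  omega

/-- **EVERY ROW `m = k − 1 + t`, `t ≥ 4`, ABOVE THE THRESHOLD:** for `t ≥ 4` and `t² + 6 ≤ 2k + t` every
`K₄⁻`-free graph with `k − 1 + t` edges on `k` vertices has `Σ_v C(d(v), 2) ≤ C(k − 1, 2) + 2t`. -/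
theorem cherries_le_choose_two_add_two_mul_of_k4mFree (t : ℕ) (ht : 4 ≤ t) (D : SimpleGraph V)
    [DecidableRel D.Adj] (hK : K4mFree D) (hk : t * t + 6 ≤ 2 * Fintype.card V + t)
    (hm : D.edgeFinset.card + 1 = Fintype.card V + t) :
    cherries D ≤ (Fintype.card V - 1).choose 2 + 2 * t := by
  obtain ⟨s, rfl⟩ : ∃ s, t = s + 4 := ⟨t - 4, by omega⟩
  clear ht
  by_cases hdeg : ∀ v, deg D v ≤ s + 4
  · -- every degree `≤ t`: `2·cherries ≤ (t − 1) Σ d = (t − 1)·2m`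
    have h2 : 2 * cherries D ≤ (s + 4 - 1) * ∑ v, deg D v := by
      unfold cherries
      rw [mul_sum, mul_sum]
      exact sum_le_sum (fun v _ => two_mul_choose_two_le_pred_mul _ _ (hdeg v))
    rw [sum_deg_eq] at h2
    have h3 : s + 4 - 1 = s + 3 := by omega
    rw [h3] at h2
    have hsq : s + 4 ≤ (s + 4) * (s + 4) := Nat.le_mul_self _
    obtain ⟨K, hK1⟩ : ∃ K, Fintype.card V = K + 1 := ⟨Fintype.card V - 1, by omega⟩
    rw [hK1] at hk hm ⊢
    rw [Nat.add_sub_cancel]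
    have h4 := degree_cap_arith K s hk
    have h5 : D.edgeFinset.card = K + (s + 4) := by omega
    rw [h5] at h2
    have h6 : (s + 3) * (2 * (K + (s + 4))) = 2 * ((s + 3) * (K + (s + 4))) := by ring
    rw [h6] at h2
    omega
  · push Not at hdeg
    obtain ⟨u, hu⟩ := hdeg
    -- a vertex of maximum degree, of degree `≥ t + 1`
    obtain ⟨v, -, hmax⟩ := exists_max_image univ (deg D) ⟨u, mem_univ u⟩
    have hmax' : ∀ w, deg D w ≤ deg D v := fun w => hmax w (mem_univ w)
    have hv : s + 5 ≤ deg D v := by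
      have := hmax' u
      omega
    -- the split of `2 Σ d²` (TriangleCapDiagonal) and the counts at `v`
    have hS := sum_adjPairsAll_deg_add D
    have hsplit1 := sum_filter_add_sum_filter_not (adjPairsAll D) (fun p => p.1 = v)
      (fun p => deg D p.1 + deg D p.2)
    have hsplit2 := sum_filter_add_sum_filter_not ((adjPairsAll D).filter (fun p => ¬ p.1 = v))
      (fun p => p.2 = v) (fun p => deg D p.1 + deg D p.2)
    rw [filter_not_fst_filter_snd, filter_not_fst_filter_not_snd] at hsplit2
    have hfst := sum_filter_fst_deg_add D v
    have hsnd := sum_filter_snd_deg_add D v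
    have hA := sum_deg_neighbors_eq D v
    have hE := two_mul_card_E_le D v
    have hT := card_T_le_deg D hK v
    have hTR : ((offPairs D v).filter (fun p => D.Adj v p.1 ∧ D.Adj v p.2)).card ≤
      (offPairs D v).card := card_filter_le _ _
    have hRc := two_mul_card_edges_eq D v
    have hR1 := sum_R_add_sum_avoid_le D v
    have hc := two_mul_cherries_add D
    rw [sum_deg_eq] at hc
    have hdk : deg D v + 1 ≤ Fintype.card V := by
      have hsub : univ.filter (fun w => D.Adj v w) ⊆ univ.erase v := by
        intro w hw
        rw [mem_filter] at hw
        rw [mem_erase]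
        exact ⟨(D.ne_of_adj hw.2).symm, mem_univ _⟩
      have h1 : deg D v ≤ (univ.erase v).card := card_le_card hsub
      rw [card_erase_of_mem (mem_univ v), card_univ] at h1
      have h2 : 1 ≤ Fintype.card V := Fintype.card_pos_iff.mpr ⟨v⟩
      omega
    -- the combined linear bound with the defect sum
    have hmain : 2 * (∑ x, deg D x * deg D x) + (offPairs D v).card * deg D v +
        ∑ p ∈ offPairs D v, (avoid D v p).card ≤
        2 * (deg D v * deg D v) + 2 * deg D v +
          4 * ((offPairs D v).filter (fun p => D.Adj v p.1)).card +
          (offPairs D v).card * D.edgeFinset.card + (offPairs D v).card := by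
      linarith [hS, hsplit1, hsplit2, hfst, hsnd, hA, hR1]
    -- the structural facts, instantiated
    have hTT := card_T_mul_card_T_le D hK v
    have hthree : 3 ≤ ((offPairs D v).filter (fun p => D.Adj v p.1 ∧ D.Adj v p.2)).card →
        (offPairs D v).card ≤ ∑ p ∈ offPairs D v, (avoid D v p).card :=
      fun h => card_offPairs_le_sum_avoid_of_three_le D hK v h
    have heven := card_T_eq_two_mul D v
    have hdom : deg D v + 1 = Fintype.card V →
        ((offPairs D v).filter (fun p => D.Adj v p.1 ∧ D.Adj v p.2)).card = (offPairs D v).card :=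
      fun h => congrArg card (filter_T_eq_offPairs_of_deg_add_one_eq_card D h)
    have hfour : 4 ≤ (offEdges D v).card →
        0 < ((offPairs D v).filter (fun p => D.Adj v p.1 ∧ D.Adj v p.2)).card →
        Fintype.card V < D.edgeFinset.card → 4 ≤ ∑ p ∈ offPairs D v, (avoid D v p).card :=
      fun h1 h2 h3 => four_le_sum_avoid_of_card_lt D hK v h1 h2 h3
    have hEc := card_offEdges D v
    -- a vertex `c` of maximum off-degree, for the case of maximum degree `t + 1`
    obtain ⟨c, -, hcmax⟩ := exists_max_image univ (outDeg D v) ⟨v, mem_univ v⟩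
    have hcmax' : ∀ w, outDeg D v w ≤ outDeg D v c := fun w => hcmax w (mem_univ w)
    have hδd : outDeg D v c ≤ deg D v := (outDeg_le_deg D v c).trans (hmax' c)
    have hδ1 := sum_avoid_ge_of_outDeg D v c
    have hδ2 : outDeg D v c ≤ 3 →
        (offPairs D v).card * ((offEdges D v).card + 1 - 2 * 3) ≤ ∑ p ∈ offPairs D v, (avoid D v p).card :=
      fun h => sum_avoid_ge_of_outDeg_le D v 3 (fun w => (hcmax' w).trans h)
    -- names for the quantities
    set T := ((offPairs D v).filter (fun p => D.Adj v p.1 ∧ D.Adj v p.2)).card with hTdef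
    set M := (((offPairs D v).filter (fun p => D.Adj v p.1 ∧ D.Adj v p.2)).image
      (fun q => s(q.1, q.2))).card with hMdef
    set E := ((offPairs D v).filter (fun p => D.Adj v p.1)).card with hEdef
    set Rc := (offPairs D v).card with hRcdef
    set Y := ∑ p ∈ offPairs D v, (avoid D v p).card with hYdef
    set Ec := (offEdges D v).card with hEcdef
    set δ := outDeg D v c with hδdef
    set d := deg D v with hddef
    set m := D.edgeFinset.card with hmdef
    set k := Fintype.card V with hkdef
    set ch := cherries D with hchdef
    set s2 := ∑ x, deg D x * deg D x with hs2def
    clear_value T M E Rc Y Ec δ d m k ch s2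
    have hfin : 2 * s2 + Rc * d + Y ≤ 2 * (d * d) + 2 * d + 2 * Rc + 2 * T + Rc * m + Rc := by
      linarith [hmain, hE]
    clear hmain hS hsplit1 hsplit2 hfst hsnd hA hR1 hE hTdef hMdef hEdef hRcdef hYdef hEcdef hδdef hddef
      hmdef hkdef hchdef hs2def hmax hmax' hcmax hcmax' hu
    obtain ⟨a, rfl⟩ : ∃ a, d = s + 5 + a := ⟨d - (s + 5), by omega⟩
    obtain ⟨g, rfl⟩ : ∃ g, k = s + 6 + a + g := ⟨k - (s + 6 + a), by omega⟩
    have hm' : m = 2 * s + 9 + a + g := by omega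
    subst hm'
    have hRc' : Rc = 2 * (g + (s + 4)) := by omega
    subst hRc'
    have hEc' : Ec = g + (s + 4) := by omega
    subst hEc'
    have e1 : s + 6 + a + g - 1 = s + 5 + a + g := by omega
    rw [e1]
    have hC := two_mul_choose_two_add (s + 5 + a + g)
    -- the threshold: `2(a + g) ≥ (s + 2)(s + 3)`
    have hag0 := threshold_arith s a g hk
    -- the defect sum at maximum degree `t + 1`: `Y ≥ 2(s + 3)²`
    have hbig : a = 0 → 2 * ((s + 3) * (s + 3)) ≤ Y := by
      intro ha
      subst ha
      have hm2 := hm2_arith s g hag0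
      by_cases hδ4 : 4 ≤ δ
      · have h := off_degree_arith (g + (s + 4)) δ s hδ4 (by omega) hm2
        exact combine_delta g s δ Y hδ1 h (by omega)
      · have h := hδ2 (by omega)
        have hm7 := hm7_arith s g hag0
        have e : g + (s + 4) + 1 - 2 * 3 = g + (s + 4) - 5 := by omega
        rw [e] at h
        exact combine_small g s Y h hm7
    -- THE KEY INEQUALITY: `2T + 2t(t − 3) ≤ Y + 4ag` in every case
    have hkey : 2 * T + 2 * (s + 4) * (s + 1) ≤ Y + 4 * (a * g) := by
      rcases Nat.eq_zero_or_pos g with hg | hg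
      · -- the dominating vertex: `T = |R| = 2t`, `Y ≥ T(T − 2)/2`
        subst hg
        have hT2 := hdom (by omega)
        exact g0_arith s a Y T hT2 hTT
      · rcases Nat.eq_zero_or_pos a with ha | ha
        · -- maximum degree `t + 1`
          have h := hbig ha
          subst ha
          exact a0_arith s g Y T h hT
        · -- `a, g ≥ 1`: `4ag ≥ 2t(t − 3)` and `Y ≥ 2T`
          have hag := add_le_mul_add_one a g ha hg
          have hY : 2 * T ≤ Y := by
            by_cases h6 : 6 ≤ T
            · have := Nat.mul_le_mul_right T h6
              omega
            · by_cases h3 : 3 ≤ T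
              · have := hthree h3
                omega
              · rcases Nat.eq_zero_or_pos T with hT0 | hT0
                · omega
                · have h2 : T = 2 := by omega
                  have := hfour (by omega) hT0 (by omega)
                  omega
          exact ag_arith s a g Y T hY hag hag0
    exact row_general_arith s2 Y T a g s ch _ hfin hc hC hkey

end C047

end TriangleCap

end PercRepro
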